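import Summits.CriticalPhenomena.PercolationContinuityZ3.Theorems.PercNearOneGluingNoHeavyLowerTailAntitheticPeelTools
import HarnessLib

/-!
# `NoHeavyLowerTail` (stmt-CriticalPhenomena-4575) — antithetic cluster pairs: the INDICATOR REDUCTION (layer cake) —
# a bilinear form `Σ_t m_t (F X_t − F X'_t)(G X_t − G X'_t)` is nonnegative for ALL monotone `F, G` as soon as it is nonnegative
# for all pairs of UPPER-SET INDICATORS (prim-hp-2 gen 42; HOME/THEOREM-Cprime-delta2-cycle.md §5, MEMO-gen42 §2)

Support file (`--supports stmt-CriticalPhenomena-4575`, hull-port prover `prim-hp-2`, gen 42).  No definitions, no named facts, no sorries;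
standard axioms.

Every exact census of the programme (MEMO-gen29 … gen40, the ttrl lanes) decides an inequality `Σ_T Δ_T(F,G) ≥ 0 for all increasing F, G`
by minimising over PAIRS OF UP-SETS `(U, V)` of the poset of occurring clusters.  This file is the Lean form of that reduction, for an
arbitrary preorder `β` in place of the lattice of edge sets:
* `Antithetic.Indicator.linear_nonneg_of_upperSet` — if `Σ_{i ∈ t} a_i (𝟙_V(X i) − 𝟙_V(X' i)) ≥ 0` for every upper set `V`, then
  `Σ_{i ∈ t} a_i (G(X i) − G(X' i)) ≥ 0` for every monotone `G : β → ℝ` (induction on the number of values of `G` on the finite family: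
  `G = min(G, M₂) + (M − M₂)·𝟙_{G ≥ M}` on the family, `M > M₂` the two largest values);
* `Antithetic.Indicator.form_nonneg_of_upperSet` — the bilinear version: indicator pairs suffice for
  `Σ_{i ∈ t} m_i (F(X i) − F(X' i))(G(X i) − G(X' i)) ≥ 0`;
* `Antithetic.Indicator.sum_delta_nonneg_of_upperSet` — cluster form: for any finite family `D` of colourings,
  `Σ_{ω ∈ D} Δ_E(𝟙_U, 𝟙_V)(ω) ≥ 0` for all upper sets `U, V` of edge sets implies `Σ_{ω ∈ D} Δ_E(F,G)(ω) ≥ 0` for all monotone `F, G`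
  (so goodness `T_E(R,X) ≥ 0`, the change family of DEG-2 ELIMINATION, … may be checked on indicator pairs — the boundary lemmas of
  THEOREM C′ are proved this way).
[cite: VandenbergHaggstromKahn2005, §1 p. 3 (open cluster `C_s`)]
-/

noncomputable section

namespace Summit.CriticalPhenomena.PercolationContinuityZ3.Theorems

open scoped Classical
open Literature.Probability.Percolation

namespace Antithetic

namespace Indicator

variable {ι β : Type*} [Preorder β]

/-- The indicator `𝟙_V` of an upper set is monotone (as a real function). [folklore] -/
theorem monotone_ite_upperSet {V : Set β} (hV : IsUpperSet V) :
    Monotone fun b : β => if b ∈ V then (1 : ℝ) else 0 := by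
  intro b b' hbb'
  show (if b ∈ V then (1 : ℝ) else 0) ≤ (if b' ∈ V then (1 : ℝ) else 0)
  by_cases hb : b ∈ V
  · rw [if_pos hb, if_pos (hV hbb' hb)]
  · rw [if_neg hb]
    split_ifs <;> norm_num

/-- **Layer cake, linear form.**  If `Σ_{i ∈ t} a i · (𝟙_V(X i) − 𝟙_V(X' i)) ≥ 0` for every upper set `V ⊆ β`, then
`Σ_{i ∈ t} a i · (G (X i) − G (X' i)) ≥ 0` for every monotone `G : β → ℝ`.  (Induction on the number of values of `G` on the finite family
`{X i, X' i}`: with `M > M₂` its two largest values, `G = min(G, M₂) + (M − M₂)·𝟙_{M ≤ G}` on the family, and `{M ≤ G}` is an upper set.)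
[folklore] -/
theorem linear_nonneg_of_upperSet (t : Finset ι) (a : ι → ℝ) (X X' : ι → β)
    (h : ∀ V : Set β, IsUpperSet V →
      0 ≤ ∑ i ∈ t, a i * ((if X i ∈ V then (1 : ℝ) else 0) - (if X' i ∈ V then (1 : ℝ) else 0)))
    {G : β → ℝ} (hG : Monotone G) : 0 ≤ ∑ i ∈ t, a i * (G (X i) - G (X' i)) := by
  -- induction on the cardinality of the value set
  suffices H : ∀ k : ℕ, ∀ G : β → ℝ, Monotone G →
      (t.image (fun i => G (X i)) ∪ t.image (fun i => G (X' i))).card ≤ k → 0 ≤ ∑ i ∈ t, a i * (G (X i) - G (X' i)) from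
    H _ G hG le_rfl
  intro k
  induction k with
  | zero =>
    intro G _ hcard
    have hempty : t.image (fun i => G (X i)) ∪ t.image (fun i => G (X' i)) = ∅ := Finset.card_eq_zero.1 (Nat.le_zero.1 hcard)
    refine Finset.sum_nonneg fun i hi => ?_
    have : G (X i) ∈ t.image (fun i => G (X i)) ∪ t.image (fun i => G (X' i)) :=
      Finset.mem_union_left _ (Finset.mem_image_of_mem (fun i => G (X i)) hi)
    rw [hempty] at this
    exact absurd this (Finset.notMem_empty _)
  | succ k ih =>
    intro G hG hcard
    set S := t.image (fun i => G (X i)) ∪ t.image (fun i => G (X' i)) with hS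
    have memS : ∀ i ∈ t, G (X i) ∈ S := fun i hi => Finset.mem_union_left _ (Finset.mem_image_of_mem (fun i => G (X i)) hi)
    have memS' : ∀ i ∈ t, G (X' i) ∈ S := fun i hi => Finset.mem_union_right _ (Finset.mem_image_of_mem (fun i => G (X' i)) hi)
    by_cases hsmall : S.card ≤ 1
    · -- all values on the family agree: every difference vanishes
      refine Finset.sum_nonneg fun i hi => ?_
      have heq : G (X i) = G (X' i) := Finset.card_le_one.1 hsmall _ (memS i hi) _ (memS' i hi)
      rw [heq, sub_self, mul_zero]
    · have hne : S.Nonempty := by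
        rw [← Finset.card_pos]
        omega
      set M := S.max' hne with hM
      have hne2 : (S.erase M).Nonempty := by
        rw [← Finset.card_pos, Finset.card_erase_of_mem (Finset.max'_mem S hne)]
        omega
      set M₂ := (S.erase M).max' hne2 with hM₂
      have hM₂lt : M₂ < M := Finset.lt_max'_of_mem_erase_max' S hne (Finset.max'_mem _ hne2)
      have hleM : ∀ c ∈ S, c ≤ M := fun c hc => Finset.le_max' S c hc
      have hleM₂ : ∀ c ∈ S, c ≠ M → c ≤ M₂ := fun c hc hcM => Finset.le_max' _ c (Finset.mem_erase.2 ⟨hcM, hc⟩)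
      -- the truncated function and the top layer (introduced as opaque locals)
      obtain ⟨G', hG'⟩ : ∃ G' : β → ℝ, ∀ b, G' b = min (G b) M₂ := ⟨fun b => min (G b) M₂, fun _ => rfl⟩
      have hG'mono : Monotone G' := fun b b' hbb' => by
        rw [hG', hG']
        exact min_le_min (hG hbb') le_rfl
      obtain ⟨V, hV⟩ : ∃ V : Set β, ∀ b, b ∈ V ↔ M ≤ G b := ⟨{b | M ≤ G b}, fun _ => Iff.rfl⟩
      have hVup : IsUpperSet V := fun b b' hbb' hb => (hV b').2 (((hV b).1 hb).trans (hG hbb'))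
      -- decomposition of the values on the family
      have hdec : ∀ c ∈ S, ∀ b : β, G b = c → G b = G' b + (M - M₂) * (if b ∈ V then (1 : ℝ) else 0) := by
        intro c hc b hb
        by_cases hcM : c = M
        · have hbV : b ∈ V := by
            rw [hV, hb, hcM]
          rw [if_pos hbV]
          have : G' b = M₂ := by
            rw [hG', hb, hcM]
            exact min_eq_right hM₂lt.le
          rw [this, hb, hcM]
          ring
        · have hle : G b ≤ M₂ := hb ▸ hleM₂ c hc hcM
          have hbV : b ∉ V := by
            intro hbV
            exact absurd (lt_of_le_of_lt (((hV b).1 hbV).trans hle) hM₂lt) (lt_irrefl _)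
          rw [if_neg hbV]
          have : G' b = G b := by
            rw [hG']
            exact min_eq_left hle
          rw [this]
          ring
      -- values of G' on the family lie in S.erase M
      have hG'val : ∀ c ∈ S, ∀ b : β, G b = c → G' b ∈ S.erase M := by
        intro c hc b hb
        by_cases hcM : c = M
        · have : G' b = M₂ := by
            rw [hG', hb, hcM]
            exact min_eq_right hM₂lt.le
          rw [this]
          exact Finset.max'_mem _ hne2
        · have hle : G b ≤ M₂ := hb ▸ hleM₂ c hc hcM
          have : G' b = G b := by
            rw [hG']
            exact min_eq_left hle
          rw [this, hb]
          exact Finset.mem_erase.2 ⟨hcM, hc⟩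
      have hcard' : (t.image (fun i => G' (X i)) ∪ t.image (fun i => G' (X' i))).card ≤ k := by
        have hsub : t.image (fun i => G' (X i)) ∪ t.image (fun i => G' (X' i)) ⊆ S.erase M := by
          intro c hc
          rcases Finset.mem_union.1 hc with hc | hc
          · obtain ⟨i, hi, rfl⟩ := Finset.mem_image.1 hc
            exact hG'val _ (memS i hi) (X i) rfl
          · obtain ⟨i, hi, rfl⟩ := Finset.mem_image.1 hc
            exact hG'val _ (memS' i hi) (X' i) rfl
        have := Finset.card_le_card hsub
        rw [Finset.card_erase_of_mem (Finset.max'_mem S hne)] at this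
        omega
      have h1 : 0 ≤ ∑ i ∈ t, a i * (G' (X i) - G' (X' i)) := ih G' hG'mono hcard'
      have h2 := h V hVup
      have hsum : ∑ i ∈ t, a i * (G (X i) - G (X' i)) =
          ∑ i ∈ t, a i * (G' (X i) - G' (X' i)) +
            (M - M₂) * ∑ i ∈ t, a i * ((if X i ∈ V then (1 : ℝ) else 0) - (if X' i ∈ V then (1 : ℝ) else 0)) := by
        rw [Finset.mul_sum, ← Finset.sum_add_distrib]
        refine Finset.sum_congr rfl fun i hi => ?_
        have e1 := hdec _ (memS i hi) (X i) rfl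
        have e2 := hdec _ (memS' i hi) (X' i) rfl
        linear_combination (a i) * e1 - (a i) * e2
      rw [hsum]
      exact add_nonneg h1 (mul_nonneg (sub_nonneg.2 hM₂lt.le) h2)

/-- **Layer cake, bilinear form (INDICATOR REDUCTION).**  If
`Σ_{i ∈ t} m i · (𝟙_U(X i) − 𝟙_U(X' i)) · (𝟙_V(X i) − 𝟙_V(X' i)) ≥ 0` for all upper sets `U, V ⊆ β`, then
`Σ_{i ∈ t} m i · (F (X i) − F (X' i)) · (G (X i) − G (X' i)) ≥ 0` for all monotone `F, G : β → ℝ`. [folklore] -/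
theorem form_nonneg_of_upperSet (t : Finset ι) (m : ι → ℝ) (X X' : ι → β)
    (h : ∀ U V : Set β, IsUpperSet U → IsUpperSet V →
      0 ≤ ∑ i ∈ t, m i * ((if X i ∈ U then (1 : ℝ) else 0) - (if X' i ∈ U then (1 : ℝ) else 0)) *
        ((if X i ∈ V then (1 : ℝ) else 0) - (if X' i ∈ V then (1 : ℝ) else 0)))
    {F G : β → ℝ} (hF : Monotone F) (hG : Monotone G) :
    0 ≤ ∑ i ∈ t, m i * (F (X i) - F (X' i)) * (G (X i) - G (X' i)) := by
  -- first G (coefficients frozen at an indicator in the F-slot), then F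
  have step1 : ∀ V : Set β, IsUpperSet V →
      0 ≤ ∑ i ∈ t, (m i * ((if X i ∈ V then (1 : ℝ) else 0) - (if X' i ∈ V then (1 : ℝ) else 0))) * (F (X i) - F (X' i)) := by
    intro V hV
    refine linear_nonneg_of_upperSet t _ X X' (fun U hU => ?_) hF
    have := h U V hU hV
    refine this.trans_eq (Finset.sum_congr rfl fun i _ => ?_)
    ring
  have step2 : 0 ≤ ∑ i ∈ t, (m i * (F (X i) - F (X' i))) * (G (X i) - G (X' i)) := by
    refine linear_nonneg_of_upperSet t _ X X' (fun V hV => ?_) hG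
    refine (step1 V hV).trans_eq (Finset.sum_congr rfl fun i _ => ?_)
    ring
  exact step2

end Indicator

section Clusters

variable {V : Type*}

/-- **Indicator reduction for antithetic sums.**  For any finite family `D` of colourings: if
`Σ_{ω ∈ D} Δ_E(𝟙_U, 𝟙_V)(ω) ≥ 0` for all upper sets `U, V` of edge sets, then `Σ_{ω ∈ D} Δ_E(F, G)(ω) ≥ 0` for all monotone `F, G`
(`Δ_E(F,G)(ω) = (F(C_s(ω∩E)) − F(C_s(ωᶜ∩E)))(G(…) − G(…))`, `Peel.delta`).  In particular goodness `T_E(R,X) ≥ 0` (`D = tset`) and the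
change family of DEG-2 ELIMINATION (`D = tset.filter …`) may be tested on pairs of up-sets — the principle behind every exact census of the
programme. [this work] -/
theorem sum_delta_nonneg_of_upperSet (E : Set (Sym2 V)) (s : V) (D : Finset (Set (Sym2 V)))
    (h : ∀ U W : Set (Set (Sym2 V)), IsUpperSet U → IsUpperSet W →
      0 ≤ ∑ ω ∈ D, Peel.delta (fun C => if C ∈ U then (1 : ℝ) else 0) (fun C => if C ∈ W then (1 : ℝ) else 0) E s ω)
    {F G : Set (Sym2 V) → ℝ} (hF : Monotone F) (hG : Monotone G) :
    0 ≤ ∑ ω ∈ D, Peel.delta F G E s ω := by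
  have key := Indicator.form_nonneg_of_upperSet D (fun _ => (1 : ℝ))
    (fun ω => openEdgeCluster (ω ∩ E) s) (fun ω => openEdgeCluster (ωᶜ ∩ E) s) (fun U W hU hW => ?_) hF hG
  · refine key.trans_eq (Finset.sum_congr rfl fun ω _ => ?_)
    rw [Peel.delta, one_mul]
  · refine (h U W hU hW).trans_eq (Finset.sum_congr rfl fun ω _ => ?_)
    rw [Peel.delta, one_mul]

/-- **Goodness may be tested on indicator pairs**: if `T_E(R,X; 𝟙_U, 𝟙_W) ≥ 0` for all upper sets `U, W` of edge sets, then
`T_E(R,X; F, G) ≥ 0` for all monotone `F, G`. [this work] -/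
theorem tsum_nonneg_of_upperSet [Fintype V] (E : Set (Sym2 V)) (s : V) (R X : Set V)
    (h : ∀ U W : Set (Set (Sym2 V)), IsUpperSet U → IsUpperSet W →
      0 ≤ Peel.tsum (fun C => if C ∈ U then (1 : ℝ) else 0) (fun C => if C ∈ W then (1 : ℝ) else 0) E s R X)
    {F G : Set (Sym2 V) → ℝ} (hF : Monotone F) (hG : Monotone G) :
    0 ≤ Peel.tsum F G E s R X :=
  sum_delta_nonneg_of_upperSet E s (Peel.tset E s R X) h hF hG

end Clusters

end Antithetic

end Summit.CriticalPhenomena.PercolationContinuityZ3.Theorems
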